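import Mathlib.Algebra.Order.Archimedean.Real.Basic
import Mathlib.Algebra.Order.Floor.Semiring
import Mathlib.Order.ConditionallyCompleteLattice.Basic
import HarnessLib

/-!
# A real-variable, two-sided Fekete lemma: the linear sandwich of a quasi-additive function
# (crux `SubseqCardy`, stmt-CriticalPhenomena-5768, line `registered`, lead c6: kernel facts IV, part 2)

Route `CardyAnchoredRigidity` (decl shared with `CardyLocalRigidity`), sub-problem `CardyFormulaZ2`.
Pure real analysis, no percolation. Let `a : ℝ → ℝ` be, on `(0, ∞)`, non-negative, non-decreasing,
SUPERadditive (`a s + a t ≤ a (s + t)`) and NEARLY SUBadditive with defect `C ≥ 0` in the shifted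
form `a (s + t - 1) ≤ a s + a t + C` (`s, t ≥ 1`). Then there is a slope `l` with

  `a 1 ≤ l ≤ a 2 + C`,  `a w ≤ l w` (`w > 0`),  `l (w - 1) - C ≤ a w` (`w ≥ 1`):

`quasiadditive_linear_sandwich`. The lead applies it to `a w := -log g(L_w)`, the long-way crossing
values of a joint sequential percolation limit on the boxes `(0,w) × (0,1)` (superadditivity =
sub-multiplicativity of crossings, near-subadditivity with `C = log 2` = Harris gluing through a unit
square); `l` is then the strip crossing exponent and the conclusion is the sandwich
`e^{-l w} ≤ g(L_w) ≤ 2 e^{l (1 - w)}`.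

Proof (Fekete, M. Fekete, Math. Z. 17 (1923); cf. B. Bollobás, O. Riordan, *Percolation* (2006),
Ch. 2, Lemma 2.1 ff.): with `b t := a (t + 1) + C` (subadditive on `[0, ∞)`), iterating the two
inequalities gives `N · a w ≤ a (N w)` and `b (m t) ≤ m · b t`; comparing at `m = ⌈N w / t⌉` and
letting `N → ∞` (Archimedes) yields the KEY inequality `a w / w ≤ b t / t` for all `w, t > 0`, and
`l := sup_{w > 0} a w / w` does the rest. Helper lemmas live in the inner namespace `Quasiadditive`.
-/

noncomputable section

namespace Summit.CriticalPhenomena.CardyFormulaZ2.Cruxes.SubseqCardy.Birth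

namespace Quasiadditive

/-- Iterated superadditivity: if `a s + a t ≤ a (s + t)` for `s, t > 0`, then
`N · a w ≤ a (N w)` for every `w > 0` and every natural `N ≥ 1`. [folklore] -/
theorem nat_mul_le (a : ℝ → ℝ) (hsup : ∀ s t : ℝ, 0 < s → 0 < t → a s + a t ≤ a (s + t))
    {w : ℝ} (hw : 0 < w) : ∀ N : ℕ, 0 < N → (N : ℝ) * a w ≤ a (N * w) := by
  intro N hN
  induction N, hN using Nat.le_induction with
  | base => simp
  | succ n hn ih =>
    have hnw : 0 < (n : ℝ) * w := mul_pos (by exact_mod_cast hn) hw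
    have h := hsup _ _ hnw hw
    have e : (n : ℝ) * w + w = ((n + 1 : ℕ) : ℝ) * w := by push_cast; ring
    rw [e] at h
    push_cast at h ⊢
    linarith

/-- Iterated near-subadditivity: if `a (s + t - 1) ≤ a s + a t + C` for `s, t ≥ 1`, then the shifted
function `b t := a (t + 1) + C` satisfies `b (m t) ≤ m · b t` for every `t ≥ 0` and every natural
`m ≥ 1`. [folklore] -/
theorem shift_nat_mul_le (a : ℝ → ℝ) (C : ℝ)
    (hsub : ∀ s t : ℝ, 1 ≤ s → 1 ≤ t → a (s + t - 1) ≤ a s + a t + C) {t : ℝ} (ht : 0 ≤ t) :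
    ∀ m : ℕ, 0 < m → a (m * t + 1) + C ≤ m * (a (t + 1) + C) := by
  intro m hm
  induction m, hm using Nat.le_induction with
  | base => simp
  | succ n hn ih =>
    have hnt : (0 : ℝ) ≤ n * t := by positivity
    have h := hsub ((n : ℝ) * t + 1) (t + 1) (by linarith) (by linarith)
    have e : (n : ℝ) * t + 1 + (t + 1) - 1 = ((n + 1 : ℕ) : ℝ) * t + 1 := by push_cast; ring
    rw [e] at h
    push_cast at h ⊢
    linarith

/-- One finite step of the Fekete comparison: under the hypotheses of
`quasiadditive_linear_sandwich`, for `w, t > 0` and every natural `N ≥ 1`,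
`N · a w · t ≤ (N w + t) · (a (t + 1) + C)` (compare at `m = ⌈N w / t⌉`). [folklore] -/
theorem key_step (a : ℝ → ℝ) (C : ℝ) (hC : 0 ≤ C)
    (hmono : ∀ s t : ℝ, 0 < s → s ≤ t → a s ≤ a t) (hnn : ∀ s : ℝ, 0 < s → 0 ≤ a s)
    (hsup : ∀ s t : ℝ, 0 < s → 0 < t → a s + a t ≤ a (s + t))
    (hsub : ∀ s t : ℝ, 1 ≤ s → 1 ≤ t → a (s + t - 1) ≤ a s + a t + C)
    {w t : ℝ} (hw : 0 < w) (ht : 0 < t) {N : ℕ} (hN : 0 < N) :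
    (N : ℝ) * a w * t ≤ (N * w + t) * (a (t + 1) + C) := by
  set m : ℕ := ⌈(N : ℝ) * w / t⌉₊
  have hNw : 0 < (N : ℝ) * w := mul_pos (by exact_mod_cast hN) hw
  have hm₁ : (N : ℝ) * w / t ≤ m := Nat.le_ceil _
  have hm₂ : (m : ℝ) < N * w / t + 1 := Nat.ceil_lt_add_one (div_pos hNw ht).le
  have hmpos : 0 < m := Nat.ceil_pos.mpr (div_pos hNw ht)
  have hle : (N : ℝ) * w ≤ m * t := by rwa [div_le_iff₀ ht] at hm₁
  have hlt : (m : ℝ) * t ≤ N * w + t := by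
    have h : (m : ℝ) - 1 < N * w / t := by linarith
    rw [lt_div_iff₀ ht] at h
    linarith
  have hb : 0 ≤ a (t + 1) + C := add_nonneg (hnn _ (by linarith)) hC
  have h₁ : (N : ℝ) * a w ≤ a (N * w) := nat_mul_le a hsup hw N hN
  have h₂ : a ((N : ℝ) * w) ≤ a (m * t + 1) := hmono _ _ hNw (by linarith)
  have h₃ : a ((m : ℝ) * t + 1) + C ≤ m * (a (t + 1) + C) := shift_nat_mul_le a C hsub ht.le m hmpos
  calc (N : ℝ) * a w * t ≤ (m * (a (t + 1) + C)) * t := by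
        apply mul_le_mul_of_nonneg_right _ ht.le
        linarith
    _ = (m * t) * (a (t + 1) + C) := by ring
    _ ≤ (N * w + t) * (a (t + 1) + C) := mul_le_mul_of_nonneg_right hlt hb

/-- The KEY inequality of the Fekete sandwich: under the hypotheses of
`quasiadditive_linear_sandwich`, `a w · t ≤ w · (a (t + 1) + C)` for all `w, t > 0`, i.e. every slope
`a w / w` lies below every shifted slope `(a (t + 1) + C) / t` (let `N → ∞` in `key_step`). [folklore] -/
theorem key (a : ℝ → ℝ) (C : ℝ) (hC : 0 ≤ C)
    (hmono : ∀ s t : ℝ, 0 < s → s ≤ t → a s ≤ a t) (hnn : ∀ s : ℝ, 0 < s → 0 ≤ a s)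
    (hsup : ∀ s t : ℝ, 0 < s → 0 < t → a s + a t ≤ a (s + t))
    (hsub : ∀ s t : ℝ, 1 ≤ s → 1 ≤ t → a (s + t - 1) ≤ a s + a t + C)
    {w t : ℝ} (hw : 0 < w) (ht : 0 < t) : a w * t ≤ w * (a (t + 1) + C) := by
  have hb : 0 ≤ a (t + 1) + C := add_nonneg (hnn _ (by linarith)) hC
  refine le_of_forall_pos_lt_add fun ε hε => ?_
  obtain ⟨N, hN⟩ := exists_nat_gt (t * (a (t + 1) + C) / ε)
  have hq : 0 ≤ t * (a (t + 1) + C) / ε := div_nonneg (mul_nonneg ht.le hb) hε.le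
  have hNpos' : (0 : ℝ) < N := hq.trans_lt hN
  have hNpos : 0 < N := by exact_mod_cast hNpos'
  have hstep := key_step a C hC hmono hnn hsup hsub hw ht hNpos
  have hε' : t * (a (t + 1) + C) < N * ε := by rwa [div_lt_iff₀ hε] at hN
  have h : (N : ℝ) * (a w * t) < N * (w * (a (t + 1) + C) + ε) := by linarith
  exact lt_of_mul_lt_mul_left h hNpos'.le

end Quasiadditive

open Quasiadditive in
/-- **Two-sided Fekete lemma (linear sandwich of a quasi-additive function).** Let `a : ℝ → ℝ` be
non-decreasing and non-negative on `(0, ∞)`, superadditive (`a s + a t ≤ a (s + t)`, `s, t > 0`) and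
nearly subadditive with defect `C ≥ 0` (`a (s + t - 1) ≤ a s + a t + C`, `s, t ≥ 1`). Then there is
`l` (namely `l = sup_{w > 0} a w / w = lim a w / w`) with `a 1 ≤ l ≤ a 2 + C`, `a w ≤ l w` for
`w > 0` and `l (w - 1) - C ≤ a w` for `w ≥ 1`. [folklore] -/
theorem quasiadditive_linear_sandwich : ∀ (a : ℝ → ℝ) (C : ℝ), 0 ≤ C → (∀ s t : ℝ, 0 < s → s ≤ t → a s ≤ a t) → (∀ s : ℝ, 0 < s → 0 ≤ a s) → (∀ s t : ℝ, 0 < s → 0 < t → a s + a t ≤ a (s + t)) → (∀ s t : ℝ, 1 ≤ s → 1 ≤ t → a (s + t - 1) ≤ a s + a t + C) → ∃ l : ℝ, a 1 ≤ l ∧ l ≤ a 2 + C ∧ (∀ w : ℝ, 0 < w → a w ≤ l * w) ∧ (∀ w : ℝ, 1 ≤ w → l * (w - 1) - C ≤ a w) := by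
  intro a C hC hmono hnn hsup hsub
  -- every slope lies below every shifted slope
  have hkey : ∀ w t : ℝ, 0 < w → 0 < t → a w / w ≤ (a (t + 1) + C) / t := by
    intro w t hw ht
    rw [div_le_div_iff₀ hw ht]
    have h := key a C hC hmono hnn hsup hsub hw ht
    linarith
  -- the set of slopes, its supremum `l`
  set S : Set ℝ := (fun w : ℝ => a w / w) '' Set.Ioi 0
  have hne : S.Nonempty := ⟨a 1 / 1, 1, Set.mem_Ioi.mpr one_pos, rfl⟩
  have hbdd : BddAbove S := by
    refine ⟨(a (1 + 1) + C) / 1, ?_⟩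
    rintro x ⟨w, hw, rfl⟩
    exact hkey w 1 hw one_pos
  have hup : ∀ w : ℝ, 0 < w → a w / w ≤ sSup S := fun w hw => le_csSup hbdd ⟨w, hw, rfl⟩
  have hlow : ∀ t : ℝ, 0 < t → sSup S ≤ (a (t + 1) + C) / t := fun t ht =>
    csSup_le hne (by rintro x ⟨w, hw, rfl⟩; exact hkey w t hw ht)
  refine ⟨sSup S, ?_, ?_, ?_, ?_⟩
  · simpa using hup 1 one_pos
  · have h := hlow 1 one_pos
    rwa [div_one, one_add_one_eq_two] at h
  · intro w hw
    have h := hup w hw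
    rwa [div_le_iff₀ hw] at h
  · intro w hw
    rcases hw.eq_or_lt with rfl | hw₁
    · have h := hnn 1 one_pos
      linarith
    · have ht : 0 < w - 1 := sub_pos.mpr hw₁
      have h := hlow (w - 1) ht
      rw [sub_add_cancel, le_div_iff₀ ht] at h
      linarith

end Summit.CriticalPhenomena.CardyFormulaZ2.Cruxes.SubseqCardy.Birth
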